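import Literature.NumberTheory.LFunctions.ZeroCounting
import Literature.NumberTheory.LFunctions.SimpleZeros
import Literature.NumberTheory.LFunctions.RHWave0HardyProofs
import HarnessLib

/-!
# Levinson's `κ ≥ 1/3` from Titchmarsh's (10.29.1): the reduction to `Anderson1983_levinson_simple`

Topic `Literature/NumberTheory/LFunctions`. Proofs only (no definitions, no named facts). The
named fact `Literature.NumberTheory.LFunctions.one_third_le_criticalLineProportion`
(`ZeroCounting.lean`, rh.S15; **Levinson 1974**: `κ = liminf N₀(T)/N(T) ≥ 1/3`) is reduced to
the per-`T` form in which Levinson's theorem is printed and in which the tree already records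
it, the named fact `Literature.NumberTheory.LFunctions.Anderson1983_levinson_simple`
(`SimpleZeros.lean`; Titchmarsh–Heath-Brown §10.29, eq. (10.29.1) with Anderson's `α = 0.3532`:
`N⁽¹⁾(T) − ∑_{r ≥ 3} (r − 2) N⁽ʳ⁾(T) ≥ α N(T)` for all large `T`). Discharging that fact
discharges `one_third_le_criticalLineProportion` (and Selberg's `criticalLineProportion_pos`) by
the one-line corollaries below.

Levinson's theorem as printed is a statement "for all large `T`" (Levinson 1974, §1, p. 383:
"it will be proved … that `N₀(T) > N(T)/3`"; Theorem, p. 384: `N₀(T + U) − N₀(T) >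
(1/3)[N(T + U) − N(T)]`, `U = T/L¹⁰`, `L = log(T/2π)`, zeros counted with multiplicity (p. 434);
Titchmarsh (10.28.1): `N₀(T) ≥ α N(T)` for large `T`, `α = 0.342`); the vendored fact is its
`liminf` form. The two spellings are interchangeable by `le_criticalLineProportion_iff` below,
whose only analytic input is that `N(T) > 0` for large `T` — taken here from Hardy's theorem,
which is proved in the tree (`hardy_infinite_zeros_on_critical_line_holds`, `RHWave0HardyProofs`),
so that this file does not depend on the Riemann–von Mangoldt formula
(`tendsto_zetaZeroCount_atTop_holds` of `ZetaArgVariation.lean` would serve equally; compare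
`le_criticalLineProportion_of_eventually_mul_le` of `ZeroCountingProofs.lean`, which takes
`N(T) → ∞` as the hypothesis `tendsto_zetaZeroCount_atTop`).

## Contents (all proved)

* `ncard_le_criticalZeroCount` — a set of zeros of `ζ` on the critical segment `0 < t ≤ T`,
  each listed once, has at most `N₀(T)` elements (multiplicities are `≥ 1`);
  `simpleCriticalZeroCount_le_criticalZeroCount` — `N⁽¹⁾(T) ≤ N₀(T)`.
* `exists_pos_riemannZeta_one_half_add_eq_zero` — a zero `1/2 + iγ` with `γ > 0` (Hardy, and
  `riemannZeta_conj`); `eventually_criticalZeroCount_pos`, `eventually_zetaZeroCount_pos` —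
  `N₀(T) ≥ 1`, `N(T) ≥ 1` for all large `T`.
* `le_criticalLineProportion_of_eventually_le` — if `c N(T) ≤ N₀(T)` for all large `T` then
  `c ≤ κ` (hypothesis-free); `le_criticalLineProportion_iff` —
  `c ≤ κ ↔ ∀ ε > 0, (c − ε) N(T) ≤ N₀(T)` for all large `T` (the `∀ ε > 0, ∀ᶠ T` spelling used
  by the proportion facts of `SimpleZeros.lean`).
* `Anderson1983_levinson_simple.eventually_mul_le_criticalZeroCount` — (10.29.1) gives
  Levinson's (10.28.1) in the form `0.3532 · N(T) ≤ N₀(T)` for all large `T`;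
  `le_criticalLineProportion_of_anderson` — hence `0.3532 ≤ κ`;
  `one_third_le_criticalLineProportion_of_anderson` — **(10.29.1) ⇒ Levinson's `κ ≥ 1/3`**, the
  named fact `one_third_le_criticalLineProportion`;
  `criticalLineProportion_pos_of_anderson` — likewise Selberg's `κ > 0`
  (`criticalLineProportion_pos`).

## What is NOT here

No proof of Levinson's theorem itself. Its analytic core — Littlewood's lemma for the mollified
`ψ G` on `σ = 1/2 − R/L` (Levinson §2) and the asymptotic evaluation
`U⁻¹ ∫_T^{T+U} |ψ G(a + it)|² dt = F(R) + O(log⁵ L / L)` (Levinson §§3–15, (15.1)–(15.2); "the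
most awkward part of Levinson's argument", Titchmarsh §10.28) — is not in Mathlib or in this tree;
it stays recorded as the named fact `Anderson1983_levinson_simple`. The chain
`przz_bound ⇒ conrey_bound ⇒ one_third_le_criticalLineProportion ⇒ criticalLineProportion_pos`
between the four rh.S15 facts lives in `ZeroCountingProofs.lean` and is not repeated here.

## References

* N. Levinson, *More than one third of zeros of Riemann's zeta-function are on `σ = 1/2`*,
  Adv. Math. 13 (1974), 383–436: §1 (Theorem, p. 384), §15 (pp. 433–435) (held:
  `doi:10.1016/0001-8708(74)90074-7`).
* E. C. Titchmarsh, *The Theory of the Riemann Zeta-Function*, 2nd ed. revised by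
  D. R. Heath-Brown (1986), §10.28 eq. (10.28.1), §10.29 eq. (10.29.1).
* R. J. Anderson, *Simple zeros of the Riemann zeta-function*, J. Number Theory 17 (1983),
  176–182 (as reported in Titchmarsh §10.29).
* G. H. Hardy, *Sur les zéros de la fonction `ζ(s)` de Riemann*, C. R. Acad. Sci. Paris 158
  (1914), 1012–1014.
-/

noncomputable section

open Complex Filter Set

namespace Literature.NumberTheory.LFunctions

/-! ## Sub-counts of the critical zeros -/

/-- A set `S` of zeros of `ζ` on the critical segment `1/2 + it`, `0 < t ≤ T` — each zero listed
once — has at most `N₀(T) = criticalZeroCount T` elements: `N₀(T)` is the sum of the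
multiplicities `m(ρ) ≥ 1` (`riemannZetaZeroOrder_pos_of_mem_zetaZeroBox`) over all such zeros.
[folklore] -/
theorem ncard_le_criticalZeroCount {T : ℝ} {S : Set ℂ}
    (hS : S ⊆ {ρ ∈ zetaZeroBox (1 / 2) T | ρ.re = 1 / 2}) : S.ncard ≤ criticalZeroCount T := by
  have hC : {ρ ∈ zetaZeroBox (1 / 2) T | ρ.re = 1 / 2}.Finite :=
    (zetaZeroBox_finite _ _).subset (sep_subset _ _)
  have h1 : S.ncard ≤ hC.toFinset.card := by
    rw [← Set.ncard_eq_toFinset_card _ hC]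
    exact Set.ncard_le_ncard hS hC
  have h2 : (hC.toFinset.card : ℤ) ≤
      ∑ᶠ ρ ∈ {ρ ∈ zetaZeroBox (1 / 2) T | ρ.re = 1 / 2}, riemannZetaZeroOrder ρ := by
    rw [finsum_mem_eq_finite_toFinset_sum _ hC, Finset.card_eq_sum_ones]
    push_cast
    refine Finset.sum_le_sum fun ρ hρ ↦ ?_
    have h := DiophantineGeometry.riemannZetaZeroOrder_pos_of_mem_zetaZeroBox
      ((Set.Finite.mem_toFinset hC).1 hρ).1
    omega
  unfold criticalZeroCount
  omega

/-- `N⁽¹⁾(T) ≤ N₀(T)`: the simple zeros on the critical segment `0 < t ≤ T`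
(`simpleCriticalZeroCount`, Titchmarsh's `N⁽¹⁾(T)` of §10.29, `criticalZeroCountOfOrder_one`)
are among the zeros counted with multiplicity by `N₀(T)`. [folklore] -/
theorem simpleCriticalZeroCount_le_criticalZeroCount (T : ℝ) :
    simpleCriticalZeroCount T ≤ criticalZeroCount T := by
  unfold simpleCriticalZeroCount
  exact ncard_le_criticalZeroCount fun ρ h ↦ ⟨h.1, h.2.1⟩

/-! ## `N(T) > 0` for large `T` (Hardy) -/

/-- There is a zero `1/2 + iγ` of `ζ` with `γ > 0`: Hardy's theorem (proved in the tree,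
`hardy_infinite_zeros_on_critical_line_holds`) gives a zero `1/2 + it` with `t ≠ 0`, and
`ζ(s̄) = conj ζ(s)` (`riemannZeta_conj`) reflects it to `t > 0` if necessary. (The least such
`γ` is `14.13…`.) [cite: Hardy1914, C. R. Acad. Sci. Paris 158 (1914) 1012–1014] -/
theorem exists_pos_riemannZeta_one_half_add_eq_zero :
    ∃ γ : ℝ, 0 < γ ∧ riemannZeta (1 / 2 + γ * I) = 0 := by
  obtain ⟨t, ht, ht0⟩ := hardy_infinite_zeros_on_critical_line_holds.nontrivial.exists_ne 0
  have hz : riemannZeta (1 / 2 + t * I) = 0 := ht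
  rcases lt_or_gt_of_ne ht0 with hneg | hpos
  · refine ⟨-t, by linarith, ?_⟩
    have hconj : (starRingEnd ℂ) (1 / 2 + t * I) = 1 / 2 + ((-t : ℝ) : ℂ) * I := by
      apply Complex.ext <;> simp
    rw [← hconj, riemannZeta_conj, hz, map_zero]
  · exact ⟨t, hpos, hz⟩

/-- `N₀(T) ≥ 1` for all large `T` (indeed for `T ≥ 14.13…`): by Hardy's theorem there is a
critical zero `1/2 + iγ`, `γ > 0`, and it is counted by `N₀(T)` once `T ≥ γ`.
[cite: Hardy1914, C. R. Acad. Sci. Paris 158 (1914) 1012–1014] -/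
theorem eventually_criticalZeroCount_pos : ∀ᶠ T : ℝ in atTop, 0 < criticalZeroCount T := by
  obtain ⟨γ, hγ, hz⟩ := exists_pos_riemannZeta_one_half_add_eq_zero
  filter_upwards [eventually_ge_atTop γ] with T hT
  have hre : ((1 / 2 : ℂ) + γ * I).re = 1 / 2 := by simp
  have him : ((1 / 2 : ℂ) + γ * I).im = γ := by simp
  have h := ncard_le_criticalZeroCount (T := T) (S := {(1 / 2 : ℂ) + γ * I}) (by
    intro ρ hρ
    rw [mem_singleton_iff] at hρ
    subst hρ
    refine ⟨⟨hz, ?_, ?_, ?_, ?_⟩, hre⟩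
    · rw [hre]
    · rw [hre]; norm_num
    · rw [him]; exact hγ
    · rw [him]; exact hT)
  rw [ncard_singleton] at h
  omega

/-- `N(T) ≥ 1` for all large `T` (`N₀ ≤ N`, `criticalZeroCount_le`, and the previous lemma). The
stronger `N(T) → ∞` is the tree's `tendsto_zetaZeroCount_atTop_holds` (`ZetaArgVariation.lean`,
from the Riemann–von Mangoldt formula); this weak form, which is all the `liminf` bookkeeping
needs, only uses Hardy's theorem. [cite: Hardy1914, C. R. Acad. Sci. Paris 158 (1914) 1012–1014] -/
theorem eventually_zetaZeroCount_pos : ∀ᶠ T : ℝ in atTop, 0 < zetaZeroCount T :=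
  eventually_criticalZeroCount_pos.mono fun T hT ↦
    hT.trans_le (DiophantineGeometry.criticalZeroCount_le T)

/-! ## `liminf` bookkeeping for `κ` -/

/-- **From a per-`T` proportion to `κ`.** If `c · N(T) ≤ N₀(T)` for all large `T`, then
`c ≤ κ = liminf N₀(T)/N(T)`. Hypothesis-free form of
`le_criticalLineProportion_of_eventually_mul_le` (`ZeroCountingProofs.lean`, which takes
`N(T) → ∞` as the hypothesis `tendsto_zetaZeroCount_atTop`): only `N(T) > 0` for large `T` is
needed to divide (`eventually_zetaZeroCount_pos`, Hardy), and the `liminf` is of a function with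
values `≤ 1` (`criticalZeroCount_le`), hence cobounded. (Titchmarsh §10.28: the passage from
(10.28.1) "for large enough `T`" to a proportion.) [folklore] -/
theorem le_criticalLineProportion_of_eventually_le {c : ℝ}
    (h : ∀ᶠ T : ℝ in atTop, c * (zetaZeroCount T : ℝ) ≤ criticalZeroCount T) :
    c ≤ criticalLineProportion := by
  have hle : ∀ T : ℝ, (criticalZeroCount T : ℝ) / zetaZeroCount T ≤ 1 := fun T ↦ by
    rcases Nat.eq_zero_or_pos (zetaZeroCount T) with h0 | hpos
    · simp [h0]
    · rw [div_le_one (by exact_mod_cast hpos)]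
      exact_mod_cast DiophantineGeometry.criticalZeroCount_le T
  refine le_liminf_of_le (isCoboundedUnder_ge_of_le atTop (x := 1) hle) ?_
  filter_upwards [h, eventually_zetaZeroCount_pos] with T hT hN
  rw [le_div_iff₀ (by exact_mod_cast hN)]
  exact hT

/-- **`liminf` form versus "for all large `T`" form of a critical-line proportion.** For every
real `c`: `c ≤ κ ↔ ∀ ε > 0, (c − ε) N(T) ≤ N₀(T)` for all sufficiently large `T`. This is the
dictionary between the `Filter.liminf` spelling of `ZeroCounting.lean` (`criticalLineProportion`)
and the `∀ ε > 0, ∀ᶠ T` spelling of the proportion facts of `SimpleZeros.lean`: `→` is the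
definition of `liminf` (the ratio `N₀/N` is `≥ 0`; where `N(T) = 0` the inequality is trivial),
`←` is `le_criticalLineProportion_of_eventually_le` for every `c − ε`. [folklore] -/
theorem le_criticalLineProportion_iff {c : ℝ} :
    c ≤ criticalLineProportion ↔
      ∀ ε : ℝ, 0 < ε →
        ∀ᶠ T : ℝ in atTop, (c - ε) * (zetaZeroCount T : ℝ) ≤ criticalZeroCount T := by
  constructor
  · intro hc ε hε
    have hb : IsBoundedUnder (· ≥ ·) atTop
        (fun T : ℝ ↦ (criticalZeroCount T : ℝ) / zetaZeroCount T) :=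
      isBoundedUnder_of ⟨0, fun T ↦ by positivity⟩
    have hlt : c - ε < criticalLineProportion := by linarith
    filter_upwards [eventually_lt_of_lt_liminf hlt hb] with T hT
    rcases Nat.eq_zero_or_pos (zetaZeroCount T) with h0 | hpos
    · simp [h0]
    · exact ((lt_div_iff₀ (by exact_mod_cast hpos)).1 hT).le
  · intro h
    exact le_of_forall_sub_le fun ε hε ↦ le_criticalLineProportion_of_eventually_le (h ε hε)

/-! ## Levinson's theorem from Titchmarsh's (10.29.1) -/

/-- (10.29.1) in the `N₀` language: from `α N(T) ≤ N⁽¹⁾(T) − ∑_{r ≥ 3} (r − 2) N⁽ʳ⁾(T)` for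
`T ≥ T₀` (`α = 0.3532`), `∑_{r ≥ 3} (r − 2) N⁽ʳ⁾(T) ≥ 0` (`levinsonCorrection_nonneg`) and
`N⁽¹⁾(T) ≤ N₀(T)` (`simpleCriticalZeroCount_le_criticalZeroCount`): `0.3532 · N(T) ≤ N₀(T)` for
all large `T` — Levinson's (10.28.1) "`N₀(T) ≥ α N(T)` for large enough `T`" with Anderson's
constant. [cite: Titchmarsh1986, §10.29 (10.29.1) and §10.28 (10.28.1)] -/
theorem Anderson1983_levinson_simple.eventually_mul_le_criticalZeroCount
    (h : Anderson1983_levinson_simple) :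
    ∀ᶠ T : ℝ in atTop, 0.3532 * (zetaZeroCount T : ℝ) ≤ criticalZeroCount T := by
  obtain ⟨T₀, hT₀⟩ := h
  filter_upwards [eventually_ge_atTop T₀] with T hT
  have h1 := hT₀ T hT
  have h2 := levinsonCorrection_nonneg T
  have h3 : (criticalZeroCountOfOrder 1 T : ℝ) ≤ criticalZeroCount T := by
    rw [criticalZeroCountOfOrder_one]
    exact_mod_cast simpleCriticalZeroCount_le_criticalZeroCount T
  linarith

/-- (10.29.1) with `α = 0.3532` gives `0.3532 ≤ κ`. [cite: Titchmarsh1986, §10.29 (10.29.1)] -/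
theorem le_criticalLineProportion_of_anderson (h : Anderson1983_levinson_simple) :
    (0.3532 : ℝ) ≤ criticalLineProportion :=
  le_criticalLineProportion_of_eventually_le h.eventually_mul_le_criticalZeroCount

/-- **Levinson's theorem (rh.S15, `κ ≥ 1/3`) from Titchmarsh's (10.29.1).** The named fact
`one_third_le_criticalLineProportion` (Levinson 1974, §1: Theorem p. 384 and "`N₀(T) > N(T)/3`"
p. 383; Titchmarsh (10.28.1) with `α = 0.342`) follows from the named fact
`Anderson1983_levinson_simple` ((10.29.1) with `α = 0.3532 ≥ 1/3`), so that discharging the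
latter discharges the former.
[cite: Levinson1974, §1 Theorem (p. 384); Titchmarsh1986 §10.28 (10.28.1), §10.29 (10.29.1)] -/
theorem one_third_le_criticalLineProportion_of_anderson (h : Anderson1983_levinson_simple) :
    one_third_le_criticalLineProportion := by
  show (1 : ℝ) / 3 ≤ criticalLineProportion
  exact le_trans (by norm_num) (le_criticalLineProportion_of_anderson h)

/-- Selberg's positive-proportion fact `criticalLineProportion_pos` (`κ > 0`, Selberg 1942) also
follows from the named fact `Anderson1983_levinson_simple` (`0 < 1/3 ≤ κ`).
[cite: Titchmarsh1986, §10.29 (10.29.1)] -/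
theorem criticalLineProportion_pos_of_anderson (h : Anderson1983_levinson_simple) :
    criticalLineProportion_pos := by
  have h' : (1 : ℝ) / 3 ≤ criticalLineProportion :=
    one_third_le_criticalLineProportion_of_anderson h
  show (0 : ℝ) < criticalLineProportion
  exact lt_of_lt_of_le (by norm_num) h'

end Literature.NumberTheory.LFunctions

end
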